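import Summits.QuantumFields.YangMills.Theorems.BalabanUVNodesN20BlockCaricatureLawSeparation
import Summits.QuantumFields.YangMills.Theorems.BalabanUVNodesN20HybridClassLawCharacterisation

/-!
# BalabanUVNodes ∕ N20·N19′·N21 — THE SUMMABLE FORM OF THE λ-DICHOTOMY (FILE C): the three faces of K3⁷ v5 stub 2 force the two runs' class laws to MERGE SUMMABLY FAST,
# so on the independent-block caricature they force `Σ_K Λ_K < ∞` (hence `Σ_K λ_K < ∞`); conversely `Σ_K √Λ_K < ∞` is SERVED there (by the shell dial, via dag-n20-w4's
# characterisation) — the critic's falsifier «is λ_K unbounded?» becomes «is λ_K SUMMABLE?», squeezed between `ℓ¹` (necessary) and `ℓ^{1∕2}` (sufficient)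

Cell `pub-ymgap` (HUMAN RULING D-0062 Track A; work-bound push D-0149, director-ym №197), width seat `pub-ymgap-dag-n20-w1` (gen 5) on node N20 = NE7b; key item K3⁷
`SpineGivenEndpointR13SepCoPH` = stmt-QuantumFields-20544 (`--kind proof --supports 20544 --as helper`); COUNT-NEUTRAL.  Bus: CLAIM-10 ∕ INTENT-14 (INBOX l.30573).
THEOREMS ONLY: no `def`, no `instance`, no `notation`, no `sorry`; imports this seat's FILE B `…N20BlockCaricatureLawSeparation` (`exists_config_sep_ge`, `one_sub_affinity_pow_le_stat`;
through it FILE A's `sum_config_eq_one`, `config_nonneg`, `affinity_config_eq_pow`, `abs_sub_le_sqrt_one_sub_affinity_sq`, `stat₁_nonneg`, `stat₁_le_statSym₁` and dag-n19-w4's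
`…N19NoDialRescuesLawSeparated.abs_classLaw_sub_le_of_faces`) and dag-n20-w4's `…N20HybridClassLawCharacterisation` (`exists_hybridNE7_of_target_of_classLawTV`, p609004, BY NAME).

WHY.  FILES A∕B decided the critic's letter (LS) inside the caricature: the laws are separated for some `s > 0` iff `Λ_K ↛ 0`, hence (dag-n19-w4 `no_dial_rescues`) `Λ_K ↛ 0`
⇒ no dial serves the three faces there.  But (LS) uses only the NULL part `ρ_K → 0` of the law merge the faces force (n19-w4 `tendsto_rho`); the faces carry MORE — their rates
`δ, W, Wsh` are SUMMABLE — and the merge radius `ρ_K = (e^{2|vol·δ_K|}∕(1 − ε_K) − 1) + ε_K` (`ε = W + Wsh`) is then summable too (§1, `ρ_K ≤ 8|vol·δ_K| + 3ε_K` once `ε_K ≤ ½`,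
`2|vol·δ_K| ≤ 1`).  So the faces force `Σ_K sup_{t,S} |μ_B − μ_A| < ∞` (§2 — the UNBUNDLED face-triple edition of dag-n20-w4's bundled `HybridNE7` theorem
`not_exists_hybridNE7_of_unsummable_classLawGap`, p607565, which has the better linear constant `2ε + 2|vol·δ|` under `lt_one ∀ K`; cited, not restated — here `ε_K < 1`
only eventually, from the summabilities), and on the caricature, where FILE B §4 exhibits at EVERY `K` a class set with gap `≥ 1 − e^{−Λ_K∕4}`, they force `Σ_K Λ_K < ∞`
(§3 ★★★ `summable_stat_of_faces_caricature`; `1 − e^{−x} ≥ x∕2` on `[0, 1]`).  CONTRAPOSITIVE (★★★ `no_dial_rescues_caricature_of_not_summable`): `Σ_K Λ_K = ∞` — in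
particular `Σ_K λ_K = ∞` for CRIT-1's one-sided `λ_K = n_K(q_K − p_K)²∕(p_K + q_K) ≤ Λ_K` — already excludes EVERY `(Bad, W, shA, shB, Wsh, δ)`, also when `λ_K → 0` and the laws
MERGE (e.g. `λ_K = 1∕K`: FILE B and n19-w4 are silent, this file bites).  So the critic's falsifier sharpens once more: «bounded or not» (CRIT-1) → «null or not» (FILE B) →
«SUMMABLE or not» (here).  §4 is the SATISFIABLE side: for `p_K ∈ (0,1)`, `Σ_K √Λ_K < ∞` ⇒ node U5's bundled `HybridNE7` (hence the face triple) HOLDS on the caricature with NO bad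
class, the TV radius `√(1 − u_K^{2n_K}) ≤ √Λ_K` paid AS SHELL WEIGHT (dag-n20-w4's p609004 «target ∧ summable class-law TV ⇒ HybridNE7» at the caricature, whose dressed partition
functions are `≡ 1` so the target holds with constants `0`).  Net: on the caricature the stub-2 face triple is SQUEEZED between `Σ Λ_K < ∞` and `Σ √Λ_K < ∞`; the exact currency is
the summability of the binomial TV sequence itself (p609004's iff), which this file brackets by the statistic from both sides.  dag-n19-w2 g5's fixed-ratio count-key road
(`exists_hybridNE7_binomial_iff` at `ε_B = κ ε_A`, linear TV bound `n|ε_A − ε_B|`, DEDUP-388) is the rare-regime twin — disjoint statements, cited.  ym-nodeO idea-3 g10's crux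
workfile `Cruxes/SpineGivenEndpointR13SepCoPH/HellingerRoadSketch.lean` (07:14Z; NOT importable from `Theorems/`) carries the Le Cam kernel and the bundled all-dials necessity
`summable_one_sub_bc_of_hybridNE7` ∕ `not_exists_hybridNE7_of_unsummable_hellinger` (§7, via p607565) as a SKETCH — §2–§3 here are the Theorems-side UNBUNDLED ∕ caricature statements
in the critic's statistic, consistent with it (`1 − bc ≥ 1 − e^{−Λ∕4}` on the caricature); cited, nothing copied.
* §1 [folklore] `rho_le_linear` (`ε ≤ ½`, `2|v| ≤ 1` ⇒ `ρ ≤ 8|v| + 3ε`, `Real.abs_exp_sub_one_le`) · `summable_rho` (the merge radius of summable rates is summable).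
* §2 generic carriers [folklore]: ★★ `summable_classLawGap_of_faces` (faces ∧ `Summable δ` ∧ positive run-A totals ⇒ for ANY admissible choice `(t_K, S_K)` the gaps
  `|μ_B(S_K) − μ_A(S_K)|` are SUMMABLE) · ★★ `no_dial_rescues_of_not_summable_classLawGap` (an admissible gap sequence that is NOT summable excludes every dial).
* §3 caricature [folklore ∕ bookkeeping]: ★★★ `summable_stat_of_faces_caricature` (faces on the caricature carriers ⇒ `Summable Λ`) · ★★★ `no_dial_rescues_caricature_of_not_summable`
  (`¬ Summable Λ` ⇒ no dial) · `no_dial_rescues_caricature_of_not_summable_stat` (the same from `¬ Summable λ`, CRIT-1's letter).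
* §4 caricature, satisfiable side [folklore ∕ bookkeeping]: `affinity₁_pos` · ★★★ `exists_hybridNE7_caricature_of_summable_sqrt_stat` (`Σ √Λ_K < ∞` ⇒ `HybridNE7` with `Bad = ∅`, `W = 0`,
  `δ = 0`, shells paying `√(1 − u^{2n})`) · ★★ `faces_caricature_of_summable_sqrt_stat` (the face triple).

HONEST FRAMING.  [folklore] real analysis ∕ finite-sum probability on a CARICATURE (independent blocks, product Bernoulli class weights — the card's simplification); nothing read
at the record (`classSet₁₃ ∕ weightA₁₃ ∕ weightB₁₃` untouched; (LS)∕(XG′)∕(SAT′) at the record UNDECIDED); proves NO estimate of Bałaban's; refutes NO registered stub (§3's negative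
statements concern the caricature carriers, not `crOfRecord₁₃V`); nothing of Bałaban's asserted or instantiated.  NE7 ∕ NE7b ∕ NE7c NOT PRINTED for `d = 4`, NOT proved;
N19 ∕ N20 ∕ N21 NOT discharged; K3⁷ OPEN, skeleton v5 941dddb108cbaacf STANDS; counts unmoved (typed 28∕28 · discharged 5∕27); no count claim.  One finite `𝕋⁴_{L^K}` programme at
fixed `ε = L^{−K}`, Bałaban AS PRINTED; the YM mass gap (Clay) is NOT proved by any of this — R4 closes the conditional finite-𝕋⁴ rung `BalabanLadder.UV` only; NOT ℝ⁴, NOT OS.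
Sources (bookkeeping only): [Balaban1988Convergent] (1.1) p.244, (2.18) p.257; [Balaban1989LargeFieldII] (1.80) p.384.  No decl carries a cite tag.
-/

set_option autoImplicit false

noncomputable section

open Finset Filter Topology
open Literature.MathematicalPhysics.QuantumFieldTheory.Balaban1983to89
open Literature.MathematicalPhysics.QuantumFieldTheory.Balaban1983to89.T4WeightBudget
open Literature.MathematicalPhysics.QuantumFieldTheory.Balaban1983to89.T4IndicatorShell
open Literature.MathematicalPhysics.QuantumFieldTheory.Balaban1983to89.T4MatchingAssembly (HybridNE7)
open Summit.QuantumFields.BalabanUV.T4Continuum.Spine.NE7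
open Summit.QuantumFields.YangMills.BalabanUVNodes.N19NoDialRescuesLawSeparated (abs_classLaw_sub_le_of_faces)
open Summit.QuantumFields.YangMills.BalabanUVNodes.N20BlockCaricatureAffinity
open Summit.QuantumFields.YangMills.BalabanUVNodes.N20BlockCaricatureLawSeparation (exists_config_sep_ge one_sub_affinity_pow_le_stat)
open Summit.QuantumFields.YangMills.BalabanUVNodes.N20HybridClassLawCharacterisation (exists_hybridNE7_of_target_of_classLawTV)

namespace Summit.QuantumFields.YangMills.BalabanUVNodes.N20BlockCaricatureSummableStatistic

/-! ## §1 Real bookkeeping: the merge radius is LINEAR in the rates near zero, hence summable -/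

/-- Near zero the merge radius `ρ = (e^{2|v|}∕(1 − ε) − 1) + ε` is linear in the rates: `0 ≤ ε ≤ ½`, `2|v| ≤ 1` ⇒ `ρ ≤ 8|v| + 3ε` (`|eˣ − 1| ≤ 2|x|` for `|x| ≤ 1`). [folklore] -/
theorem rho_le_linear {v ε : ℝ} (hε0 : 0 ≤ ε) (hε : ε ≤ 1 / 2) (hv : 2 * |v| ≤ 1) :
    (Real.exp (2 * |v|) / (1 - ε) - 1) + ε ≤ 8 * |v| + 3 * ε := by
  have h2v : (0 : ℝ) ≤ 2 * |v| := by positivity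
  have hx : abs (2 * |v|) ≤ 1 := by rwa [abs_of_nonneg h2v]
  have hexp : Real.exp (2 * |v|) - 1 ≤ 2 * (2 * |v|) := by
    have h := Real.abs_exp_sub_one_le hx
    rw [abs_of_nonneg h2v] at h
    exact (le_abs_self _).trans h
  have h1ε : 0 < 1 - ε := by linarith
  have hne : 1 - ε ≠ 0 := h1ε.ne'
  have hdiv : Real.exp (2 * |v|) / (1 - ε) - 1 = (Real.exp (2 * |v|) - 1 + ε) / (1 - ε) := by
    rw [eq_div_iff hne, sub_mul, div_mul_cancel₀ _ hne]
    ring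
  have hvε : |v| * ε ≤ |v| * (1 / 2) := mul_le_mul_of_nonneg_left hε (abs_nonneg v)
  have hεε : ε * ε ≤ ε * (1 / 2) := mul_le_mul_of_nonneg_left hε hε0
  have key : (Real.exp (2 * |v|) - 1 + ε) / (1 - ε) ≤ 8 * |v| + 2 * ε := by
    rw [div_le_iff₀ h1ε]
    nlinarith [abs_nonneg v]
  rw [hdiv]
  linarith

/-- ★ The merge radius of SUMMABLE rates is SUMMABLE (not merely null, dag-n19-w4 `tendsto_rho`). [folklore] -/
theorem summable_rho {vol : ℝ} {δ W Wsh : ℕ → ℝ} (hδ : Summable δ) (hW : Summable W) (hWsh : Summable Wsh)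
    (hW0 : ∀ K, 0 ≤ W K) (hWsh0 : ∀ K, 0 ≤ Wsh K) :
    Summable fun K => (Real.exp (2 * |vol * δ K|) / (1 - (W K + Wsh K)) - 1) + (W K + Wsh K) := by
  have hε : Tendsto (fun K => W K + Wsh K) atTop (𝓝 0) := by
    simpa using hW.tendsto_atTop_zero.add hWsh.tendsto_atTop_zero
  have hv : Tendsto (fun K => 2 * |vol * δ K|) atTop (𝓝 0) := by
    simpa using ((hδ.tendsto_atTop_zero.const_mul vol).abs).const_mul 2
  have hmaj : Summable fun K => 8 * |vol * δ K| + 3 * (W K + Wsh K) :=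
    (((hδ.mul_left vol).abs).mul_left 8).add ((hW.add hWsh).mul_left 3)
  refine Summable.of_norm_bounded_eventually_nat hmaj ?_
  filter_upwards [hε.eventually (Iic_mem_nhds (show (0 : ℝ) < 1 / 2 by norm_num)), hv.eventually (Iic_mem_nhds one_pos)] with K hεK hvK
  have hε0 : 0 ≤ W K + Wsh K := add_nonneg (hW0 K) (hWsh0 K)
  have hρ0 : 0 ≤ (Real.exp (2 * |vol * δ K|) / (1 - (W K + Wsh K)) - 1) + (W K + Wsh K) := by
    have h1 : (1 : ℝ) ≤ Real.exp (2 * |vol * δ K|) := Real.one_le_exp (by positivity)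
    have h2 : 1 ≤ Real.exp (2 * |vol * δ K|) / (1 - (W K + Wsh K)) := by
      rw [le_div_iff₀ (by linarith)]; nlinarith
    linarith
  rw [Real.norm_eq_abs, abs_of_nonneg hρ0]
  exact rho_le_linear hε0 hεK hvK

/-! ## §2 Generic carriers: the faces make the class-law gaps SUMMABLE along any admissible choice of sources and class sets -/

section Generic

variable {ι : Type*} [DecidableEq ι] {l₀ vol : ℝ} {T : ℕ → Finset ι} {A B shA shB : ℕ → ℝ → ι → ℝ} {Bad : ℕ → ℝ → Finset ι} {W Wsh δ : ℕ → ℝ}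

/-- ★★ **THE FACES FORCE A SUMMABLE LAW MERGE** [folklore] (unbundled face-triple edition of dag-n20-w4's `summable_budget_of_hybridNE7` ∕ `not_exists_hybridNE7_of_unsummable_classLawGap`,
p607565, whose bundled `HybridNE7` carries `lt_one ∀ K` and the sharper linear budget `2ε + 2|vol·δ|`): the weight face, the shell face and the core face on the cores with
`Summable δ`, positive run-A totals on the window ⇒ for EVERY choice of sources `|t_K| ≤ l₀` and class sets `S_K ⊆ T K`, the gaps `|μ_B(S_K) − μ_A(S_K)|` are SUMMABLE in `K`
(dag-n19-w4 `abs_classLaw_sub_le_of_faces` at each large `K` + `summable_rho`; `ε_K < 1` only eventually). -/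
theorem summable_classLawGap_of_faces (hW : RelWeightBound l₀ T A B Bad W) (hSh : ShellWeightBound l₀ T A B shA shB Wsh)
    (hcore : Core l₀ vol T Bad (fun K t τ => A K t τ - shA K t τ) (fun K t τ => B K t τ - shB K t τ) δ) (hδ : Summable δ)
    (hpos : ∀ K t, |t| ≤ l₀ → 0 < ∑ τ ∈ T K, A K t τ)
    (t : ℕ → ℝ) (ht : ∀ K, |t K| ≤ l₀) (S : ℕ → Finset ι) (hS : ∀ K, S K ⊆ T K) :
    Summable fun K => |(∑ τ ∈ S K, B K (t K) τ) / (∑ τ ∈ T K, B K (t K) τ) - (∑ τ ∈ S K, A K (t K) τ) / (∑ τ ∈ T K, A K (t K) τ)| := by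
  have hρ := summable_rho (vol := vol) hδ hW.summable hSh.summable hW.nonneg hSh.nonneg
  have hε : Tendsto (fun K => W K + Wsh K) atTop (𝓝 0) := by
    simpa using hW.summable.tendsto_atTop_zero.add hSh.summable.tendsto_atTop_zero
  refine Summable.of_norm_bounded_eventually_nat hρ ?_
  filter_upwards [hε.eventually (gt_mem_nhds one_pos)] with K hεK
  rw [Real.norm_eq_abs, abs_abs]
  exact abs_classLaw_sub_le_of_faces hW hSh hcore hεK (ht K) (hpos K (t K) (ht K)) (hS K)

/-- ★★ **NO DIAL RESCUES A NON-SUMMABLY SEPARATED PAIR** [folklore]: one admissible choice `(t_K, S_K)` along which the class-law gaps are NOT summable (e.g. `≥ g_K ≥ 0` with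
`Σ g_K = ∞` — a gap tending to `0` is allowed) excludes every `(Bad, W, shA, shB, Wsh, δ)` from giving the three faces of K3⁷ stub 2 — strictly beyond the (LS) no-go
(dag-n19-w4 `no_dial_rescues`: gap `≥ s > 0` infinitely often). -/
theorem no_dial_rescues_of_not_summable_classLawGap (hpos : ∀ K t, |t| ≤ l₀ → 0 < ∑ τ ∈ T K, A K t τ)
    (t : ℕ → ℝ) (ht : ∀ K, |t K| ≤ l₀) (S : ℕ → Finset ι) (hS : ∀ K, S K ⊆ T K)
    (hns : ¬ Summable fun K => |(∑ τ ∈ S K, B K (t K) τ) / (∑ τ ∈ T K, B K (t K) τ) - (∑ τ ∈ S K, A K (t K) τ) / (∑ τ ∈ T K, A K (t K) τ)|) :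
    ¬ ∃ (Bad : ℕ → ℝ → Finset ι) (W : ℕ → ℝ) (shA shB : ℕ → ℝ → ι → ℝ) (Wsh δ : ℕ → ℝ),
      RelWeightBound l₀ T A B Bad W ∧ ShellWeightBound l₀ T A B shA shB Wsh ∧
      (Core l₀ vol T Bad (fun K t τ => A K t τ - shA K t τ) (fun K t τ => B K t τ - shB K t τ) δ ∧ Summable δ) := by
  rintro ⟨Bad, W, shA, shB, Wsh, δ, hW, hSh, hcore, hδ⟩
  exact hns (summable_classLawGap_of_faces hW hSh hcore hδ hpos t ht S hS)

end Generic

/-! ## §3 The caricature: the faces force `Σ_K Λ_K < ∞`; a non-summable statistic excludes every dial -/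

section Caricature

variable (n : ℕ → ℕ) (p q : ℕ → ℝ) (Λ : ℕ → ℝ)

/-- ★★★ **THE FACES FORCE A SUMMABLE STATISTIC** [folklore ∕ bookkeeping]: if some `(Bad, W, shA, shB, Wsh, δ)` gives the three faces of K3⁷ stub 2 on the caricature carriers
(`T K = (range n_K).powerset`, product Bernoulli class weights, any `l₀ ≥ 0`, any `vol`), then `Σ_K Λ_K < ∞`.  Chain: FILE B §4 gives at EVERY `K` a class set with gap
`≥ 1 − e^{−Λ_K∕4} ≥ 0`; §2 makes these gaps summable; a summable `1 − e^{−Λ_K∕4}` is eventually `< 1 − e^{−1}`, so `Λ_K ≤ 4` eventually and there `Λ_K∕8 ≤ 1 − e^{−Λ_K∕4}`. -/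
theorem summable_stat_of_faces_caricature (hp : ∀ K, 0 ≤ p K ∧ p K ≤ 1) (hq : ∀ K, 0 ≤ q K ∧ q K ≤ 1)
    (hΛ : ∀ K, Λ K = n K * ((q K - p K) ^ 2 / (p K + q K) + (q K - p K) ^ 2 / (2 - p K - q K)))
    {l₀ : ℝ} (hl₀ : 0 ≤ l₀) {vol : ℝ} {Bad : ℕ → ℝ → Finset (Finset ℕ)} {W : ℕ → ℝ} {shA shB : ℕ → ℝ → Finset ℕ → ℝ} {Wsh δ : ℕ → ℝ}
    (hW : RelWeightBound l₀ (fun K => (Finset.range (n K)).powerset) (fun K _ S => p K ^ S.card * (1 - p K) ^ (n K - S.card))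
      (fun K _ S => q K ^ S.card * (1 - q K) ^ (n K - S.card)) Bad W)
    (hSh : ShellWeightBound l₀ (fun K => (Finset.range (n K)).powerset) (fun K _ S => p K ^ S.card * (1 - p K) ^ (n K - S.card))
      (fun K _ S => q K ^ S.card * (1 - q K) ^ (n K - S.card)) shA shB Wsh)
    (hcore : Core l₀ vol (fun K => (Finset.range (n K)).powerset) Bad (fun K t S => p K ^ S.card * (1 - p K) ^ (n K - S.card) - shA K t S)
      (fun K t S => q K ^ S.card * (1 - q K) ^ (n K - S.card) - shB K t S) δ) (hδ : Summable δ) :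
    Summable Λ := by
  -- the witness class sets of FILE B §4, one per `K`
  choose S hS hsep using fun K => exists_config_sep_ge (hp K).1 (hq K).1 (hp K).2 (hq K).2 (n K)
  have hΛ0 : ∀ K, 0 ≤ Λ K := fun K => by
    rw [hΛ K]; exact mul_nonneg (Nat.cast_nonneg _) (stat₁_nonneg (hp K).1 (hq K).1 (hp K).2 (hq K).2)
  -- run-A totals are `1 > 0`; the source is irrelevant (`t := 0`); §2 makes the gaps along `(0, S_K)` summable
  have hpos : ∀ (K : ℕ) (t : ℝ), |t| ≤ l₀ → 0 < ∑ τ ∈ (Finset.range (n K)).powerset, p K ^ τ.card * (1 - p K) ^ (n K - τ.card) :=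
    fun K t _ => by rw [sum_config_eq_one]; exact one_pos
  have ht0 : ∀ K : ℕ, |(fun _ : ℕ => (0 : ℝ)) K| ≤ l₀ := fun _ => by simpa using hl₀
  have hgap := summable_classLawGap_of_faces hW hSh hcore hδ hpos (fun _ => 0) ht0 S hS
  -- the gaps dominate `g_K := 1 − e^{−Λ_K∕4} ≥ 0`, so `g` is summable
  have hg : Summable fun K => 1 - Real.exp (-Λ K / 4) := by
    refine Summable.of_nonneg_of_le (fun K => ?_) (fun K => ?_) hgap
    · have : Real.exp (-Λ K / 4) ≤ Real.exp 0 := Real.exp_le_exp.2 (by linarith [hΛ0 K])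
      rw [Real.exp_zero] at this; linarith
    · have h := hsep K
      rw [← hΛ K] at h
      simp only [sum_config_eq_one, div_one]
      exact h.trans (le_abs_self _)
  -- eventually `Λ_K ≤ 4`, and there `Λ_K∕8 ≤ g_K`
  have hg0 := hg.tendsto_atTop_zero
  have hev : ∀ᶠ K in atTop, Λ K ≤ 4 := by
    have hc : (0 : ℝ) < 1 - Real.exp (-1) := by
      have : Real.exp (-1) < Real.exp 0 := Real.exp_lt_exp.2 (by norm_num)
      rw [Real.exp_zero] at this; linarith
    filter_upwards [hg0.eventually (gt_mem_nhds hc)] with K hK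
    by_contra h4
    have : Real.exp (-Λ K / 4) ≤ Real.exp (-1) := Real.exp_le_exp.2 (by linarith [not_le.1 h4])
    linarith
  refine Summable.of_norm_bounded_eventually_nat (hg.mul_left 8) ?_
  filter_upwards [hev] with K hK
  rw [Real.norm_eq_abs, abs_of_nonneg (hΛ0 K)]
  -- `x∕2 ≤ 1 − e^{−x}` on `[0, 1]` at `x := Λ_K∕4` (from `1 + x ≤ eˣ`; the tree's `Literature/NumberTheory/LFunctions/PrimeReciprocalWindows` has it as
  -- `half_le_one_sub_exp_neg` — a three-line fact inlined rather than importing an L-functions module)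
  have hx0 : 0 ≤ Λ K / 4 := by linarith [hΛ0 K]
  have h1 : Real.exp (-(Λ K / 4)) * (1 + Λ K / 4) ≤ 1 := by
    calc Real.exp (-(Λ K / 4)) * (1 + Λ K / 4) ≤ Real.exp (-(Λ K / 4)) * Real.exp (Λ K / 4) :=
          mul_le_mul_of_nonneg_left (by linarith [Real.add_one_le_exp (Λ K / 4)]) (Real.exp_pos _).le
      _ = 1 := by rw [← Real.exp_add, neg_add_cancel, Real.exp_zero]
  have h : Λ K / 4 / 2 ≤ 1 - Real.exp (-(Λ K / 4)) := by nlinarith [Real.exp_pos (-(Λ K / 4))]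
  have e : Real.exp (-(Λ K / 4)) = Real.exp (-Λ K / 4) := by congr 1; ring
  rw [e] at h
  linarith

/-- ★★★ **NO DIAL RESCUES THE CARICATURE FROM A NON-SUMMABLE STATISTIC** [folklore ∕ bookkeeping]: `Σ_K Λ_K = ∞` ⇒ on the caricature carriers NO `(Bad, W, shA, shB, Wsh, δ)`
gives `RelWeightBound ∧ ShellWeightBound ∧ (Core ∧ Summable δ)` (any `l₀ ≥ 0`, any `vol`) — also when `Λ_K → 0` and the laws merge (FILE B's `no_dial_rescues_caricature` needs
`Λ_K ≥ λ₀` infinitely often; this needs only non-summability). -/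
theorem no_dial_rescues_caricature_of_not_summable (hp : ∀ K, 0 ≤ p K ∧ p K ≤ 1) (hq : ∀ K, 0 ≤ q K ∧ q K ≤ 1)
    (hΛ : ∀ K, Λ K = n K * ((q K - p K) ^ 2 / (p K + q K) + (q K - p K) ^ 2 / (2 - p K - q K)))
    {l₀ : ℝ} (hl₀ : 0 ≤ l₀) (hns : ¬ Summable Λ) (vol : ℝ) :
    ¬ ∃ (Bad : ℕ → ℝ → Finset (Finset ℕ)) (W : ℕ → ℝ) (shA shB : ℕ → ℝ → Finset ℕ → ℝ) (Wsh δ : ℕ → ℝ),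
      RelWeightBound l₀ (fun K => (Finset.range (n K)).powerset) (fun K _ S => p K ^ S.card * (1 - p K) ^ (n K - S.card))
        (fun K _ S => q K ^ S.card * (1 - q K) ^ (n K - S.card)) Bad W ∧
      ShellWeightBound l₀ (fun K => (Finset.range (n K)).powerset) (fun K _ S => p K ^ S.card * (1 - p K) ^ (n K - S.card))
        (fun K _ S => q K ^ S.card * (1 - q K) ^ (n K - S.card)) shA shB Wsh ∧
      (Core l₀ vol (fun K => (Finset.range (n K)).powerset) Bad (fun K t S => p K ^ S.card * (1 - p K) ^ (n K - S.card) - shA K t S)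
        (fun K t S => q K ^ S.card * (1 - q K) ^ (n K - S.card) - shB K t S) δ ∧ Summable δ) := by
  rintro ⟨Bad, W, shA, shB, Wsh, δ, hW, hSh, hcore, hδ⟩
  exact hns (summable_stat_of_faces_caricature n p q Λ hp hq hΛ hl₀ hW hSh hcore hδ)

/-- The same from CRIT-1's one-sided letter: `Σ_K n_K (q_K − p_K)²∕(p_K + q_K) = ∞` suffices (`λ ≤ Λ`, comparison). [folklore ∕ bookkeeping] -/
theorem no_dial_rescues_caricature_of_not_summable_stat (hp : ∀ K, 0 ≤ p K ∧ p K ≤ 1) (hq : ∀ K, 0 ≤ q K ∧ q K ≤ 1)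
    {l₀ : ℝ} (hl₀ : 0 ≤ l₀) (hns : ¬ Summable fun K => n K * ((q K - p K) ^ 2 / (p K + q K))) (vol : ℝ) :
    ¬ ∃ (Bad : ℕ → ℝ → Finset (Finset ℕ)) (W : ℕ → ℝ) (shA shB : ℕ → ℝ → Finset ℕ → ℝ) (Wsh δ : ℕ → ℝ),
      RelWeightBound l₀ (fun K => (Finset.range (n K)).powerset) (fun K _ S => p K ^ S.card * (1 - p K) ^ (n K - S.card))
        (fun K _ S => q K ^ S.card * (1 - q K) ^ (n K - S.card)) Bad W ∧
      ShellWeightBound l₀ (fun K => (Finset.range (n K)).powerset) (fun K _ S => p K ^ S.card * (1 - p K) ^ (n K - S.card))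
        (fun K _ S => q K ^ S.card * (1 - q K) ^ (n K - S.card)) shA shB Wsh ∧
      (Core l₀ vol (fun K => (Finset.range (n K)).powerset) Bad (fun K t S => p K ^ S.card * (1 - p K) ^ (n K - S.card) - shA K t S)
        (fun K t S => q K ^ S.card * (1 - q K) ^ (n K - S.card) - shB K t S) δ ∧ Summable δ) := by
  refine no_dial_rescues_caricature_of_not_summable n p q
    (fun K => n K * ((q K - p K) ^ 2 / (p K + q K) + (q K - p K) ^ 2 / (2 - p K - q K))) hp hq (fun _ => rfl) hl₀ (fun hs => hns ?_) vol
  refine Summable.of_nonneg_of_le (fun K => mul_nonneg (Nat.cast_nonneg _) (div_nonneg (sq_nonneg _) (add_nonneg (hp K).1 (hq K).1))) (fun K => ?_) hs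
  exact mul_le_mul_of_nonneg_left (stat₁_le_statSym₁ (hp K).2 (hq K).2) (Nat.cast_nonneg _)

end Caricature

/-! ## §4 The caricature, satisfiable side: `Σ_K √Λ_K < ∞` is SERVED — by the shell dial, via dag-n20-w4's characterisation BY NAME -/

section Satisfiable

variable (n : ℕ → ℕ) (p q : ℕ → ℝ) (Λ : ℕ → ℝ)

/-- The per-block affinity is POSITIVE once `p ∈ (0, 1)` and `q ≥ 0` (one of `√(pq)`, `√((1−p)(1−q))` is positive; for `q > 1` Lean's `√` of a negative reads `0`). [folklore] -/
theorem affinity₁_pos {p q : ℝ} (hp0 : 0 < p) (hp1 : p < 1) (hq0 : 0 ≤ q) :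
    0 < Real.sqrt (p * q) + Real.sqrt ((1 - p) * (1 - q)) := by
  rcases hq0.eq_or_lt with h | h
  · rw [← h]
    have : 0 < Real.sqrt ((1 - p) * (1 - 0)) := Real.sqrt_pos.2 (by nlinarith)
    linarith [Real.sqrt_nonneg (p * 0)]
  · have : 0 < Real.sqrt (p * q) := Real.sqrt_pos.2 (mul_pos hp0 h)
    linarith [Real.sqrt_nonneg ((1 - p) * (1 - q))]

/-- ★★★ **`Σ_K √Λ_K < ∞` IS SERVED ON THE CARICATURE, BY THE SHELL DIAL** [folklore ∕ bookkeeping]: for `p_K ∈ (0, 1)`, `q_K ∈ [0, 1]`, any `l₀ ≥ 0`, any `vol`: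
if `Σ_K √Λ_K < ∞` then SOME shells `shA, shB` and shell weights `Wsh` give node U5's bundled binder list `HybridNE7` on the caricature carriers with NO bad class (`Bad = ∅`,
`W = 0`) and radius `δ = 0` — hence the three faces of K3⁷ stub 2.  Mechanism: the caricature's dressed partition functions are `≡ 1`, so node U5's `Target vol l₀ 0 1` holds
with constants `0`; every class set has `|μ_A − μ_B| ≤ ρ_K := √(1 − u_K^{2n_K}) ≤ √Λ_K` (FILE A `abs_sub_le_sqrt_one_sub_affinity_sq` ∘ `affinity_config_eq_pow`, FILE B
`one_sub_affinity_pow_le_stat`), `ρ_K < 1` (`u_K > 0`), `Σ ρ_K < ∞`; dag-n20-w4's `…N20HybridClassLawCharacterisation.exists_hybridNE7_of_target_of_classLawTV` (p609004) turns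
«target ∧ summable class-law TV radius» into `HybridNE7` with the TV radius paid AS SHELL WEIGHT.  With §3: on the caricature the stub-2 face triple is SQUEEZED between
`Σ Λ_K < ∞` (necessary) and `Σ √Λ_K < ∞` (sufficient). -/
theorem exists_hybridNE7_caricature_of_summable_sqrt_stat (hp : ∀ K, 0 < p K ∧ p K < 1) (hq : ∀ K, 0 ≤ q K ∧ q K ≤ 1)
    (hΛ : ∀ K, Λ K = n K * ((q K - p K) ^ 2 / (p K + q K) + (q K - p K) ^ 2 / (2 - p K - q K)))
    {l₀ : ℝ} (hl₀ : 0 ≤ l₀) (vol : ℝ) (hsum : Summable fun K => Real.sqrt (Λ K)) :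
    ∃ (shA shB : ℕ → ℝ → Finset ℕ → ℝ) (Wsh : ℕ → ℝ),
      HybridNE7 l₀ vol (fun K => (Finset.range (n K)).powerset) (fun K _ S => p K ^ S.card * (1 - p K) ^ (n K - S.card))
        (fun K _ S => q K ^ S.card * (1 - q K) ^ (n K - S.card)) (fun _ _ => ∅) (fun _ => 0) shA shB Wsh (fun _ => 0) := by
  have hp' : ∀ K, 0 ≤ p K ∧ p K ≤ 1 := fun K => ⟨(hp K).1.le, (hp K).2.le⟩
  -- the TV radius paid as shell weight: `ρ_K := √(1 − u_K^{2 n_K})`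
  set ρ : ℕ → ℝ := fun K => Real.sqrt (1 - (Real.sqrt (p K * q K) + Real.sqrt ((1 - p K) * (1 - q K))) ^ (n K * 2)) with hρ
  have hρ0 : ∀ K, 0 ≤ ρ K := fun K => Real.sqrt_nonneg _
  have hρ1 : ∀ K, ρ K < 1 := fun K => by
    have hu := affinity₁_pos (hp K).1 (hp K).2 (hq K).1
    rw [hρ]
    refine (Real.sqrt_lt' one_pos).2 ?_
    rw [one_pow]
    linarith [pow_pos hu (n K * 2)]
  have hρle : ∀ K, ρ K ≤ Real.sqrt (Λ K) := fun K => by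
    rw [hρ, hΛ K]
    exact Real.sqrt_le_sqrt (one_sub_affinity_pow_le_stat (hp' K).1 (hq K).1 (hp' K).2 (hq K).2 (n K))
  have hρs : Summable ρ := Summable.of_nonneg_of_le hρ0 hρle hsum
  -- node U5's target at the caricature: totals `≡ 1`, constants `0`, radius `0`
  have hT : Target vol l₀ (fun _ => 0) (fun _ _ => (1 : ℝ)) := ⟨fun K => ⟨0, fun t _ => by simp⟩, summable_zero⟩
  obtain ⟨shA, shB, h⟩ := exists_hybridNE7_of_target_of_classLawTV (vol := vol) (T := fun K => (Finset.range (n K)).powerset)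
    (A := fun K _ S => p K ^ S.card * (1 - p K) ^ (n K - S.card)) (B := fun K _ S => q K ^ S.card * (1 - q K) ^ (n K - S.card)) hl₀
    (fun K t _ S _ => config_nonneg (hp' K).1 (hp' K).2 (n K) S) (fun K t _ S _ => config_nonneg (hq K).1 (hq K).2 (n K) S)
    (fun K t _ => by rw [sum_config_eq_one]; exact one_pos) (fun K t _ => by rw [sum_config_eq_one]; exact one_pos)
    (Z := fun _ _ => (1 : ℝ)) (fun K t _ => (sum_config_eq_one (p K) (n K)).symm) (fun K t _ => (sum_config_eq_one (q K) (n K)).symm) hT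
    hρ0 hρ1 hρs (fun K t _ S hS => by
      have h := abs_sub_le_sqrt_one_sub_affinity_sq (Finset.range (n K)).powerset
        (a := fun S => p K ^ S.card * (1 - p K) ^ (n K - S.card)) (b := fun S => q K ^ S.card * (1 - q K) ^ (n K - S.card))
        (fun S _ => config_nonneg (hp' K).1 (hp' K).2 (n K) S) (fun S _ => config_nonneg (hq K).1 (hq K).2 (n K) S)
        (sum_config_eq_one (p K) (n K)) (sum_config_eq_one (q K) (n K)) hS
      rw [affinity_config_eq_pow (hp' K).1 (hq K).1 (hp' K).2 (hq K).2 (n K), ← pow_mul] at h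
      rw [sum_config_eq_one, sum_config_eq_one, div_one, div_one, abs_sub_comm]
      exact h)
  exact ⟨shA, shB, ρ, h⟩

/-- ★★ **THE FACE TRIPLE FROM `Σ_K √Λ_K < ∞`** [folklore ∕ bookkeeping]: the corollary of the previous theorem in the stub-2 shape (`RelWeightBound ∧ ShellWeightBound ∧ (Core ∧ Summable δ)`)
— the non-vacuous half of §3's criterion: on the caricature the summable currency is the right one, up to the gap between `ℓ¹` (necessary) and `ℓ^{1∕2}` (sufficient) of the
critic's statistic (the binomial TV sequence itself is the exact currency, dag-n20-w4's `exists_hybridNE7_iff_target_and_classLawTV`). -/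
theorem faces_caricature_of_summable_sqrt_stat (hp : ∀ K, 0 < p K ∧ p K < 1) (hq : ∀ K, 0 ≤ q K ∧ q K ≤ 1)
    (hΛ : ∀ K, Λ K = n K * ((q K - p K) ^ 2 / (p K + q K) + (q K - p K) ^ 2 / (2 - p K - q K)))
    {l₀ : ℝ} (hl₀ : 0 ≤ l₀) (vol : ℝ) (hsum : Summable fun K => Real.sqrt (Λ K)) :
    ∃ (Bad : ℕ → ℝ → Finset (Finset ℕ)) (W : ℕ → ℝ) (shA shB : ℕ → ℝ → Finset ℕ → ℝ) (Wsh δ : ℕ → ℝ),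
      RelWeightBound l₀ (fun K => (Finset.range (n K)).powerset) (fun K _ S => p K ^ S.card * (1 - p K) ^ (n K - S.card))
        (fun K _ S => q K ^ S.card * (1 - q K) ^ (n K - S.card)) Bad W ∧
      ShellWeightBound l₀ (fun K => (Finset.range (n K)).powerset) (fun K _ S => p K ^ S.card * (1 - p K) ^ (n K - S.card))
        (fun K _ S => q K ^ S.card * (1 - q K) ^ (n K - S.card)) shA shB Wsh ∧
      (Core l₀ vol (fun K => (Finset.range (n K)).powerset) Bad (fun K t S => p K ^ S.card * (1 - p K) ^ (n K - S.card) - shA K t S)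
        (fun K t S => q K ^ S.card * (1 - q K) ^ (n K - S.card) - shB K t S) δ ∧ Summable δ) := by
  obtain ⟨shA, shB, Wsh, h⟩ := exists_hybridNE7_caricature_of_summable_sqrt_stat n p q Λ hp hq hΛ hl₀ vol hsum
  exact ⟨fun _ _ => ∅, fun _ => 0, shA, shB, Wsh, fun _ => 0, h.weight, h.shell, core_of_hybridNE7 h, h.summable⟩

end Satisfiable

end Summit.QuantumFields.YangMills.BalabanUVNodes.N20BlockCaricatureSummableStatistic

end
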